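import Summits.HodgeConjecture.HodgeConjecture.Theorems.R90S4EpsNormTransversal      -- ★ p863962 (this seat) M4-b: `stableEpsOrbitalIntegral_eq_sum_of_normTransversal`, `sum_classEpsOrbitalIntegral_mul_eq_stableEpsOrbitalIntegral_mul_of_normTransversal`; brings ★ p863871 (`epsNorm_eq_one_of_mem_normFibre`, `epsNorm_mul_eq_coe_of_epsNorm_eq_one`), ★ α p863634, ★ CartanNormMap p863295
import Summits.HodgeConjecture.HodgeConjecture.Theorems.R90S4CartanMeasures            -- ★ p863623 (p12): `Gqs`, `cartanWeight`; brings the ★ LH6 Cartan tower (`isClosed_cartan`, `centralizer_eq_cartan_of_isRegularElt`, `isOpen_setOf_isRegularElt_cmDatum_local`)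
import Summits.HodgeConjecture.HodgeConjecture.Theorems.R90S4SplitFormHermitian        -- ★ `splitFormGL_isHermitian` (the `hΦ` letter at the form of record)
import HarnessLib

/-!
# R90-TF · S4 «Ch. 13.1–2», T-WIF road, (B1-T) part 1 — THE SHEETED TRANSVERSAL OF A CARTAN: from a Borel norm section `s : T → T̃` and representatives `R` of
# `K_T = T̃ᴺ ∕ (1−ε)T̃`, the set `B₀ = ⋃_{u ∈ R} s(T^{reg})·u` is a Borel transversal of the ε-regular `(1−ε)T̃`-cosets, and its reference measure is the sum of the sheets
# (Rogawski 1990, §12.5 p. 186; §3.11 pp. 34–35)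

Cell `hodgecm-mathlib`, crux H413 (`stmt-HodgeConjecture-24833`, lane `--supports … --as helper`), route of record `HCCMUnconditional` (no route verbs;
count-neutral).  Programme R90-TF, section S4 = [Rogawski1990] Ch. 13.1–13.2; seat R90-C131-p03 (g3); the letter (L2) ⇒ (L1) step of `R90/R90-C131-p03/g3/CENSUS-B1-assembly.md`
§2 (plan of record S4-R30; dealer S4 K2E2-plan (g7)).  THEOREMS ONLY — no `def`, no instance, no notation, no named-fact hypothesis, no `sorry`; ★-only imports.

HONEST LABEL: HC_CM is proved only modulo the 7 printed citations (2 remaining named inputs: hLiu418 = stmt-HodgeConjecture-24832, h413 =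
stmt-HodgeConjecture-24833) until rung 0 closes.  Group algebra and descriptive measure theory at the S4 carriers; the norm section (L2), the `K_T`-representatives (K-FIN ★
p863945 gives a cover; a transversal is a HYPOTHESIS here) and the twisted Jacobian (J̃♭) are untouched (REL ≠ ★ ≠ BUILT).

## The mathematics

SETTING (`v` arbitrary; `G_v = (UnitaryGroup.cmDatum L 3 (splitFormGL L : Matrix (Fin 3) (Fin 3) L)).Local v = U(Φ₃)(L⁺_v)`, `G̃_v = GtLoc L v`, `ε = ε_v` for `Φ₃ = splitFormGL L`, hermitian ★ `splitFormGL_isHermitian`): `T = Z_{G_v}(γ₀)` a Cartan subgroup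
(`γ₀` regular), `T̃ = Cent_{G̃_v}(γ₀)` (abelian, ε-stable, `N : T̃ → T` onto — ★ p863295), `s : T → T̃` a NORM SECTION (`N(s t) = t`; the letter (L2), any map here, Borel where
said), `R ⊆ T̃` a finite TRANSVERSAL of `T̃ᴺ = Ker N` modulo `(1−ε)T̃ = {a ε(a)⁻¹}` (the letters `hRN ∕ hRcov ∕ hRinj` — ★ p863871's shape moved into the subtype `↥T̃`).
* §1 SHEETS: for `u ∈ R` the sheet map `t ↦ s(t)·u : T → T̃` has `N(s(t) u) = t`; over a regular `t` the points `s(t) u`, `u ∈ R`, form a NORM TRANSVERSAL over `t` (norms `= t`,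
  pairwise ε-inequivalent, meeting every ε-class of norm `t`: ★ `normTransversal_mul_of_kernelRepresentatives` read in `↥T̃`), so ★ M4-b gives
  `Σ_{u ∈ R} Φ_ε(⟦s(t) u⟧, φ) β(s(t) u) = Φ^{st}_ε(δ₀, φ) β(δ₀)` for every `δ₀` with `t ∈ 𝒩(δ₀)` and every ε-stable `β`.
* §2 THE TRANSVERSAL `B₀ := {b ∈ T̃ | ∃ t ∈ T^{reg}, ∃ u ∈ R, b = s(t) u}`: it consists of ε-regular points, two points of `B₀` differing by an element of `(1−ε)T̃` are equal, and every
  ε-regular `b ∈ T̃` has a `(1−ε)T̃`-translate in `B₀` — the three (L1) letters of ★ M1-TWIST `R90S4TwistedConjugationFamilyFibres`, DERIVED.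
* §3 MEASURABILITY: for a Borel `s` every sheet map is a measurable injection of the standard Borel space `T`, so `B₀` is Borel (Lusin–Souslin, Mathlib
  `MeasurableSet.image_of_measurable_injOn`) and integrals against the SHEET MEASURE `λ = Σ_{u ∈ R} (t ↦ s(t) u)_*(t_T|_{T^{reg}})` unpack as `∫ F dλ = Σ_u ∫_{T^{reg}} F(s(t) u) dt_T`.
USE: part 2 (`R90S4TwistedTubeFormula`) feeds §2 to ★ M1-TWIST ((LI), (FC)), §3's `λ` to ★ M2♭ (`R90S4EquivariantFamilyTubeJacobian`) as the reference measure of (J̃♭), and §1 to close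
the torus side on `∫_{T^{reg}} D_T(t) Φ^{st}_ε(sec₀ t, φ) β(sec₀ t) dt_T`.

[cite: Rogawski1990, §12.5 p. 186; §3.11 Prop. 3.11.1 (a)–(c), Prop. 3.11.2 pp. 34–35] [cite: Kechris1995, Thm. 15.1]
-/

set_option autoImplicit false
-- the mandated namespace repeats the single-problem summit's segment (`HodgeConjecture.HodgeConjecture`)
set_option linter.dupNamespace false

noncomputable section

open MeasureTheory Measure Set Filter Topology Function NumberField IsDedekindDomain
open scoped ENNReal NNReal MatrixGroups Pointwise

namespace Summit.HodgeConjecture.HodgeConjecture.R90.S4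

open Literature.NumberTheory.Rogawski1990 Literature.NumberTheory.Rogawski1990.Ch4Sec10
open Literature.NumberTheory.Automorphic Literature.NumberTheory.Automorphic.UnitaryGroup
open Summit.HodgeConjecture.HodgeConjecture.Cruxes.H413.F0P3cStCharTSWeylCartanRadial

section Sheets

variable {L : Type} [Field L] [NumberField L] [IsCMField L] {v : HeightOneSpectrum (𝓞 ↥(maximalRealSubfield L))}
  {T : Subgroup ((UnitaryGroup.cmDatum L 3 (splitFormGL L : Matrix (Fin 3) (Fin 3) L)).Local v)} {γ₀ : (UnitaryGroup.cmDatum L 3 (splitFormGL L : Matrix (Fin 3) (Fin 3) L)).Local v} (hγ₀ : IsRegularElt (γ₀.val : GtLoc L v)) (hT : T = Subgroup.centralizer ({γ₀} : Set ((UnitaryGroup.cmDatum L 3 (splitFormGL L : Matrix (Fin 3) (Fin 3) L)).Local v)))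
  (s : ↥T → ↥(Subgroup.centralizer ({(γ₀.val : GtLoc L v)} : Set (GtLoc L v))))
  (hsN : ∀ t : ↥T, epsNorm (epsLoc L (splitFormGL L) v) (s t : GtLoc L v) = ((t : (UnitaryGroup.cmDatum L 3 (splitFormGL L : Matrix (Fin 3) (Fin 3) L)).Local v)).val)
  (R : Finset ↥(Subgroup.centralizer ({(γ₀.val : GtLoc L v)} : Set (GtLoc L v))))
  (hRN : ∀ u ∈ R, epsNorm (epsLoc L (splitFormGL L) v) (u : GtLoc L v) = 1)
  (hRcov : ∀ w : ↥(Subgroup.centralizer ({(γ₀.val : GtLoc L v)} : Set (GtLoc L v))), epsNorm (epsLoc L (splitFormGL L) v) (w : GtLoc L v) = 1 →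
    ∃ u ∈ R, ∃ a : ↥(Subgroup.centralizer ({(γ₀.val : GtLoc L v)} : Set (GtLoc L v))),
      (w : GtLoc L v) = u * (a * (epsLoc L (splitFormGL L) v a)⁻¹))
  (hRinj : ∀ u ∈ R, ∀ u' ∈ R, (∃ a : ↥(Subgroup.centralizer ({(γ₀.val : GtLoc L v)} : Set (GtLoc L v))),
      ((u' : ↥(Subgroup.centralizer ({(γ₀.val : GtLoc L v)} : Set (GtLoc L v)))) : GtLoc L v) = u * (a * (epsLoc L (splitFormGL L) v a)⁻¹)) → u = u')

/-! ## §1 Sheets over a regular `t ∈ T` form a norm transversal -/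

include hT in
/-- The underlying `G̃_v`-element of `t ∈ T = Z(γ₀)` commutes with `γ₀`: `↑t ∈ T̃`. [cite: Rogawski1990, §12.5 p. 186] -/
theorem coe_val_mem_centralizer (t : ↥T) : ((t : (UnitaryGroup.cmDatum L 3 (splitFormGL L : Matrix (Fin 3) (Fin 3) L)).Local v)).val ∈ Subgroup.centralizer ({(γ₀.val : GtLoc L v)} : Set (GtLoc L v)) := by
  have ht : (t : (UnitaryGroup.cmDatum L 3 (splitFormGL L : Matrix (Fin 3) (Fin 3) L)).Local v) ∈ Subgroup.centralizer ({γ₀} : Set ((UnitaryGroup.cmDatum L 3 (splitFormGL L : Matrix (Fin 3) (Fin 3) L)).Local v)) := hT ▸ t.2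
  exact (coe_mem_centralizer_coe_iff γ₀ (t : (UnitaryGroup.cmDatum L 3 (splitFormGL L : Matrix (Fin 3) (Fin 3) L)).Local v)).2 ht

include hγ₀ hT in
/-- **For a regular `t ∈ T`, `Cent_{G̃_v}(t) = T̃ = Cent_{G̃_v}(γ₀)`** (★ `centralizer_eq_centralizer_of_isRegularElt`). [cite: Rogawski1990, §12.5 p. 186; §3.1 p. 19] -/
theorem centralizer_coe_eq_of_isRegularElt (t : ↥T) (ht : IsRegularElt (((t : (UnitaryGroup.cmDatum L 3 (splitFormGL L : Matrix (Fin 3) (Fin 3) L)).Local v)).val : GtLoc L v)) :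
    Subgroup.centralizer ({(((t : (UnitaryGroup.cmDatum L 3 (splitFormGL L : Matrix (Fin 3) (Fin 3) L)).Local v)).val : GtLoc L v)} : Set (GtLoc L v)) = Subgroup.centralizer ({(γ₀.val : GtLoc L v)} : Set (GtLoc L v)) :=
  centralizer_eq_centralizer_of_isRegularElt hγ₀ ht (coe_val_mem_centralizer hT t)

include hγ₀ hsN hRN in
/-- **`N(s(t) u) = t`** for `u ∈ R` (`N` multiplicative on `T̃`, `N u = 1`). [cite: Rogawski1990, §12.5 p. 186] -/
theorem epsNorm_sheet (t : ↥T) (u : ↥(Subgroup.centralizer ({(γ₀.val : GtLoc L v)} : Set (GtLoc L v)))) (hu : u ∈ R) :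
    epsNorm (epsLoc L (splitFormGL L) v) ((s t * u : ↥(Subgroup.centralizer ({(γ₀.val : GtLoc L v)} : Set (GtLoc L v)))) : GtLoc L v) = ((t : (UnitaryGroup.cmDatum L 3 (splitFormGL L : Matrix (Fin 3) (Fin 3) L)).Local v)).val := by
  rw [Subgroup.coe_mul, epsNorm_mul_of_mem_centralizer hγ₀ (s t).2 u.2, hRN u hu, mul_one, hsN t]

include hγ₀ hT hsN hRN hRcov hRinj in
/-- **THE SHEETS OVER A REGULAR `t` FORM A NORM TRANSVERSAL**: the family `u ↦ s(t) u` (`u ∈ R`) has norms `= t`, is pairwise ε-inequivalent, and meets every ε-class of norm `t`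
(★ `normTransversal_mul_of_kernelRepresentatives` at `t₀ := s(t)`, with the `K_T`-letters read in `↥T̃` and `Cent(t) = Cent(γ₀)`). [cite: Rogawski1990, §12.5 p. 186; §3.11 Prop. 3.11.1 (c) p. 34] -/
theorem normTransversal_sheet (t : ↥T) (ht : IsRegularElt (((t : (UnitaryGroup.cmDatum L 3 (splitFormGL L : Matrix (Fin 3) (Fin 3) L)).Local v)).val : GtLoc L v)) :
    (∀ u : ↥R, epsNorm (epsLoc L (splitFormGL L) v) ((s t : GtLoc L v) * ((u : ↥(Subgroup.centralizer ({(γ₀.val : GtLoc L v)} : Set (GtLoc L v)))) : GtLoc L v)) =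
        ((t : (UnitaryGroup.cmDatum L 3 (splitFormGL L : Matrix (Fin 3) (Fin 3) L)).Local v)).val) ∧
      (∀ u u' : ↥R, IsEpsConj (epsLoc L (splitFormGL L) v) ((s t : GtLoc L v) * ((u : ↥(Subgroup.centralizer ({(γ₀.val : GtLoc L v)} : Set (GtLoc L v)))) : GtLoc L v))
        ((s t : GtLoc L v) * ((u' : ↥(Subgroup.centralizer ({(γ₀.val : GtLoc L v)} : Set (GtLoc L v)))) : GtLoc L v)) → u = u') ∧
      (∀ t' : GtLoc L v, epsNorm (epsLoc L (splitFormGL L) v) t' = ((t : (UnitaryGroup.cmDatum L 3 (splitFormGL L : Matrix (Fin 3) (Fin 3) L)).Local v)).val →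
        ∃ u : ↥R, IsEpsConj (epsLoc L (splitFormGL L) v) ((s t : GtLoc L v) * ((u : ↥(Subgroup.centralizer ({(γ₀.val : GtLoc L v)} : Set (GtLoc L v)))) : GtLoc L v)) t') := by
  have hΦ := splitFormGL_isHermitian L
  have hcent := centralizer_coe_eq_of_isRegularElt hγ₀ hT t ht
  have hN : ∀ u : ↥R, epsNorm (epsLoc L (splitFormGL L) v) ((s t : GtLoc L v) * ((u : ↥(Subgroup.centralizer ({(γ₀.val : GtLoc L v)} : Set (GtLoc L v)))) : GtLoc L v)) =
      ((t : (UnitaryGroup.cmDatum L 3 (splitFormGL L : Matrix (Fin 3) (Fin 3) L)).Local v)).val := fun u => by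
    have h := epsNorm_sheet hγ₀ s hsN R hRN t u u.2
    rwa [Subgroup.coe_mul] at h
  refine ⟨hN, fun u u' h => ?_, fun t' ht' => ?_⟩
  · -- ε-conjugate sheets differ by `(1−ε)T̃` (★ α), so `u′ = u · a ε(a)⁻¹`, so `u = u′`
    obtain ⟨a, ha, heq⟩ := (isEpsConj_iff_exists_mem_centralizer_of_epsNorm_eq_coe hΦ (γ := (t : (UnitaryGroup.cmDatum L 3 (splitFormGL L : Matrix (Fin 3) (Fin 3) L)).Local v)) ht (hN u) (hN u')).1 h
    rw [hcent] at ha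
    have heq' : (((u' : ↥(Subgroup.centralizer ({(γ₀.val : GtLoc L v)} : Set (GtLoc L v)))) : GtLoc L v)) = (u : GtLoc L v) * (a * (epsLoc L (splitFormGL L) v a)⁻¹) := by
      rw [mul_assoc] at heq
      exact mul_left_cancel heq
    exact Subtype.ext (hRinj u u.2 u' u'.2 ⟨⟨a, ha⟩, heq'⟩)
  · -- every `t′` of norm `t` is `s(t) · w` with `N w = 1`, `w ∈ T̃`, hence `(s(t) u) · a ε(a)⁻¹` for some `u ∈ R`
    obtain ⟨hwT, hwN⟩ := epsNorm_eq_one_of_mem_normFibre hΦ (γ := (t : (UnitaryGroup.cmDatum L 3 (splitFormGL L : Matrix (Fin 3) (Fin 3) L)).Local v)) ht (hsN t) ht'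
    rw [hcent] at hwT
    obtain ⟨u, hu, a, hw⟩ := hRcov ⟨_, hwT⟩ hwN
    refine ⟨⟨u, hu⟩, ?_⟩
    have ht'eq : t' = (s t : GtLoc L v) * (u : GtLoc L v) * ((a : GtLoc L v) * (epsLoc L (splitFormGL L) v a)⁻¹) := by
      have h1 : t' = (s t : GtLoc L v) * ((s t : GtLoc L v)⁻¹ * t') := by rw [mul_inv_cancel_left]
      rw [h1]
      change (s t : GtLoc L v) * (((⟨(s t : GtLoc L v)⁻¹ * t', hwT⟩ : ↥(Subgroup.centralizer ({(γ₀.val : GtLoc L v)} : Set (GtLoc L v)))) : GtLoc L v)) = _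
      rw [hw, mul_assoc]
    rw [ht'eq]
    exact isEpsConj_mul_mul_epsLoc_inv_of_commute
      (mul_comm_of_mem_centralizer_of_isRegularElt hγ₀ a.2 (Subgroup.mul_mem _ (s t).2 u.2))

include hγ₀ hT hsN hRN hRcov hRinj in
/-- **THE NORM FIBRE SUM ALONG THE SHEETS — `Σ_{u ∈ R} Φ_ε(⟦s(t) u⟧, φ) β(s(t) u) = Φ^{st}_ε(δ₀, φ) β(δ₀)`** for a regular `t ∈ T`, every `δ₀` with `t ∈ 𝒩(δ₀)` (e.g. `δ₀ = sec₀ t`) and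
every ε-stable class function `β` (★ M4-b over the transversal of §1). [cite: Rogawski1990, §12.5 p. 186; §4.10 (4.10.1) p. 57] -/
theorem sum_sheet_classEpsOrbitalIntegral_mul_eq [∀ δ : GtLoc L v, MeasurableSpace (GtLoc L v ⧸ epsCentralizer (epsLoc L (splitFormGL L) v) δ)]
    (mGt : EpsOrbitalMeasureFamily (epsLoc L (splitFormGL L) v) ⊥) (φ : GtLoc L v → ℂ)
    (β : GtLoc L v → ℂ) (hβ : ∀ δ δ' : GtLoc L v, IsStablyEpsConjAt L (splitFormGL L) v δ δ' → β δ = β δ')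
    (t : ↥T) (ht : IsRegularElt (((t : (UnitaryGroup.cmDatum L 3 (splitFormGL L : Matrix (Fin 3) (Fin 3) L)).Local v)).val : GtLoc L v)) {δ₀ : GtLoc L v} (hδ₀ : IsEpsNormPair L (splitFormGL L) v δ₀ (t : (UnitaryGroup.cmDatum L 3 (splitFormGL L : Matrix (Fin 3) (Fin 3) L)).Local v)) :
    ∑ u ∈ R, classEpsOrbitalIntegral (epsLoc L (splitFormGL L) v) mGt φ
          (Quotient.mk (Relation.EqvGen.setoid (epsConjModRel (epsLoc L (splitFormGL L) v) ⊥)) ((s t * u : ↥(Subgroup.centralizer ({(γ₀.val : GtLoc L v)} : Set (GtLoc L v)))) : GtLoc L v)) *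
        β ((s t * u : ↥(Subgroup.centralizer ({(γ₀.val : GtLoc L v)} : Set (GtLoc L v)))) : GtLoc L v) =
      stableEpsOrbitalIntegral L (splitFormGL L) v mGt φ δ₀ * β δ₀ := by
  obtain ⟨hN, hinj, hcov⟩ := normTransversal_sheet hγ₀ hT s hsN R hRN hRcov hRinj t ht
  rw [← sum_classEpsOrbitalIntegral_mul_eq_stableEpsOrbitalIntegral_mul_of_normTransversal (splitFormGL_isHermitian L) hδ₀ mGt φ
    (fun u : ↥R => (s t : GtLoc L v) * ((u : ↥(Subgroup.centralizer ({(γ₀.val : GtLoc L v)} : Set (GtLoc L v)))) : GtLoc L v)) hN hinj hcov β hβ]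
  exact (Finset.sum_coe_sort R fun u => classEpsOrbitalIntegral (epsLoc L (splitFormGL L) v) mGt φ
    (Quotient.mk (Relation.EqvGen.setoid (epsConjModRel (epsLoc L (splitFormGL L) v) ⊥)) ((s t * u : ↥(Subgroup.centralizer ({(γ₀.val : GtLoc L v)} : Set (GtLoc L v)))) : GtLoc L v)) *
      β ((s t * u : ↥(Subgroup.centralizer ({(γ₀.val : GtLoc L v)} : Set (GtLoc L v)))) : GtLoc L v)).symm

/-! ## §2 `B₀ = ⋃_{u ∈ R} s(T^{reg})·u` is a transversal of the ε-regular `(1−ε)T̃`-cosets (the (L1) letters of ★ M1-TWIST, derived) -/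

include hγ₀ hsN hRN in
/-- **Points of `B₀` are ε-regular**: `N(s(t) u) = t` is regular. [cite: Rogawski1990, §3.11 p. 34] -/
theorem isEpsRegularAt_of_mem_sheetTransversal {b : ↥(Subgroup.centralizer ({(γ₀.val : GtLoc L v)} : Set (GtLoc L v)))}
    (hb : b ∈ {b : ↥(Subgroup.centralizer ({(γ₀.val : GtLoc L v)} : Set (GtLoc L v))) |
      ∃ t : ↥T, IsRegularElt (((t : (UnitaryGroup.cmDatum L 3 (splitFormGL L : Matrix (Fin 3) (Fin 3) L)).Local v)).val : GtLoc L v) ∧ ∃ u ∈ R, b = s t * u}) :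
    IsEpsRegularAt L (splitFormGL L) v (b : GtLoc L v) := by
  obtain ⟨t, ht, u, hu, rfl⟩ := hb
  rw [isEpsRegularAt_iff, epsNorm_sheet hγ₀ s hsN R hRN t u hu]
  exact ht

include hγ₀ hsN hRN hRinj in
/-- **Two points of `B₀` differing by an element of `(1−ε)T̃` are equal**: their norms agree, so the `T`-points agree, so the representatives differ by `a ε(a)⁻¹` and coincide
(`hRinj`). [cite: Rogawski1990, §12.5 p. 186; §3.11 Prop. 3.11.1 (c) p. 34] -/
theorem eq_of_mem_sheetTransversal_of_mul_eq
    {b b' : ↥(Subgroup.centralizer ({(γ₀.val : GtLoc L v)} : Set (GtLoc L v)))}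
    (hb : b ∈ {b : ↥(Subgroup.centralizer ({(γ₀.val : GtLoc L v)} : Set (GtLoc L v))) | ∃ t : ↥T, IsRegularElt (((t : (UnitaryGroup.cmDatum L 3 (splitFormGL L : Matrix (Fin 3) (Fin 3) L)).Local v)).val : GtLoc L v) ∧ ∃ u ∈ R, b = s t * u})
    (hb' : b' ∈ {b : ↥(Subgroup.centralizer ({(γ₀.val : GtLoc L v)} : Set (GtLoc L v))) | ∃ t : ↥T, IsRegularElt (((t : (UnitaryGroup.cmDatum L 3 (splitFormGL L : Matrix (Fin 3) (Fin 3) L)).Local v)).val : GtLoc L v) ∧ ∃ u ∈ R, b = s t * u})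
    (h : ∃ a ∈ Subgroup.centralizer ({(γ₀.val : GtLoc L v)} : Set (GtLoc L v)), ((b' : ↥(Subgroup.centralizer ({(γ₀.val : GtLoc L v)} : Set (GtLoc L v)))) : GtLoc L v) =
      b * (a * (epsLoc L (splitFormGL L) v a)⁻¹)) : b = b' := by
  have hΦ := splitFormGL_isHermitian L
  obtain ⟨t, ht, u, hu, rfl⟩ := hb
  obtain ⟨t', ht', u', hu', rfl⟩ := hb'
  obtain ⟨a, ha, heq⟩ := h
  -- the norms agree, so `t = t′`
  have hN := epsNorm_sheet hγ₀ s hsN R hRN t u hu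
  have hN' := epsNorm_sheet hγ₀ s hsN R hRN t' u' hu'
  have htt : t = t' := by
    have haC : a * (epsLoc L (splitFormGL L) v a)⁻¹ ∈ Subgroup.centralizer ({(γ₀.val : GtLoc L v)} : Set (GtLoc L v)) :=
      Subgroup.mul_mem _ ha (Subgroup.inv_mem _ (epsLoc_mem_centralizer_coe γ₀ ha))
    have h1 : epsNorm (epsLoc L (splitFormGL L) v) ((s t' * u' : ↥(Subgroup.centralizer ({(γ₀.val : GtLoc L v)} : Set (GtLoc L v)))) : GtLoc L v) =
        epsNorm (epsLoc L (splitFormGL L) v) ((s t * u : ↥(Subgroup.centralizer ({(γ₀.val : GtLoc L v)} : Set (GtLoc L v)))) : GtLoc L v) := by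
      rw [heq, epsNorm_mul_of_mem_centralizer hγ₀ (s t * u).2 haC, epsNorm_mul_epsLoc_inv hΦ a, mul_one]
    rw [hN, hN'] at h1
    exact Subtype.ext (Subtype.ext h1.symm)
  subst htt
  -- then `u′ = u · a ε(a)⁻¹`, so `u = u′`
  have hu'eq : (((u' : ↥(Subgroup.centralizer ({(γ₀.val : GtLoc L v)} : Set (GtLoc L v)))) : GtLoc L v)) = (u : GtLoc L v) * (a * (epsLoc L (splitFormGL L) v a)⁻¹) := by
    have h2 : (s t : GtLoc L v) * (u' : GtLoc L v) = (s t : GtLoc L v) * ((u : GtLoc L v) * (a * (epsLoc L (splitFormGL L) v a)⁻¹)) := by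
      simpa only [Subgroup.coe_mul, mul_assoc] using heq
    exact mul_left_cancel h2
  rw [hRinj u hu u' hu' ⟨⟨a, ha⟩, hu'eq⟩]

set_option maxHeartbeats 400000 in
include hγ₀ hT hsN hRcov in
/-- **Every ε-regular `b ∈ T̃` has a `(1−ε)T̃`-translate in `B₀`**: `N b = t` is regular, `s(t)⁻¹ b ∈ T̃ᴺ` is `u · a ε(a)⁻¹` (`hRcov`), so `b · a⁻¹ ε(a⁻¹)⁻¹ = s(t) u ∈ B₀`.
[cite: Rogawski1990, §12.5 p. 186; §3.11 Prop. 3.11.1 (b)(c) pp. 34–35] -/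
theorem exists_mem_sheetTransversal_of_isEpsRegularAt (b : ↥(Subgroup.centralizer ({(γ₀.val : GtLoc L v)} : Set (GtLoc L v))))
    (hb : IsEpsRegularAt L (splitFormGL L) v (b : GtLoc L v)) :
    ∃ b₀ ∈ {b : ↥(Subgroup.centralizer ({(γ₀.val : GtLoc L v)} : Set (GtLoc L v))) | ∃ t : ↥T, IsRegularElt (((t : (UnitaryGroup.cmDatum L 3 (splitFormGL L : Matrix (Fin 3) (Fin 3) L)).Local v)).val : GtLoc L v) ∧ ∃ u ∈ R, b = s t * u},
      ∃ a ∈ Subgroup.centralizer ({(γ₀.val : GtLoc L v)} : Set (GtLoc L v)),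
        ((b₀ : ↥(Subgroup.centralizer ({(γ₀.val : GtLoc L v)} : Set (GtLoc L v)))) : GtLoc L v) = b * (a * (epsLoc L (splitFormGL L) v a)⁻¹) := by
  have hΦ := splitFormGL_isHermitian L
  -- the norm of `b` is a regular element `t` of `T`
  obtain ⟨t₁, ht₁⟩ := exists_centralizer_coe_eq_epsNorm hΦ hγ₀ b.2
  have ht₁T : (t₁ : (UnitaryGroup.cmDatum L 3 (splitFormGL L : Matrix (Fin 3) (Fin 3) L)).Local v) ∈ T := hT ▸ t₁.2
  set t : ↥T := ⟨(t₁ : (UnitaryGroup.cmDatum L 3 (splitFormGL L : Matrix (Fin 3) (Fin 3) L)).Local v), ht₁T⟩ with htdef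
  have hNb : epsNorm (epsLoc L (splitFormGL L) v) (b : GtLoc L v) = ((t : (UnitaryGroup.cmDatum L 3 (splitFormGL L : Matrix (Fin 3) (Fin 3) L)).Local v)).val := ht₁.symm
  have ht : IsRegularElt (((t : (UnitaryGroup.cmDatum L 3 (splitFormGL L : Matrix (Fin 3) (Fin 3) L)).Local v)).val : GtLoc L v) := by
    rw [← hNb]; exact (isEpsRegularAt_iff L (splitFormGL L) v _).1 hb
  -- `s(t)⁻¹ b ∈ T̃ᴺ` decomposes as `u · a ε(a)⁻¹`
  obtain ⟨hwT, hwN⟩ := epsNorm_eq_one_of_mem_normFibre hΦ (γ := (t : (UnitaryGroup.cmDatum L 3 (splitFormGL L : Matrix (Fin 3) (Fin 3) L)).Local v)) ht (hsN t) hNb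
  rw [centralizer_coe_eq_of_isRegularElt hγ₀ hT t ht] at hwT
  obtain ⟨u, hu, a, hw⟩ := hRcov ⟨_, hwT⟩ hwN
  refine ⟨s t * u, ⟨t, ht, u, hu, rfl⟩, (a : GtLoc L v)⁻¹, Subgroup.inv_mem _ a.2, ?_⟩
  have hb_eq : (b : GtLoc L v) = (s t : GtLoc L v) * (u : GtLoc L v) * ((a : GtLoc L v) * (epsLoc L (splitFormGL L) v a)⁻¹) := by
    have h1 : (b : GtLoc L v) = (s t : GtLoc L v) * ((s t : GtLoc L v)⁻¹ * b) := by rw [mul_inv_cancel_left]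
    rw [h1]
    change (s t : GtLoc L v) * (((⟨(s t : GtLoc L v)⁻¹ * b, hwT⟩ : ↥(Subgroup.centralizer ({(γ₀.val : GtLoc L v)} : Set (GtLoc L v)))) : GtLoc L v)) = _
    rw [hw, mul_assoc]
  have hc : ((a : GtLoc L v))⁻¹ * epsLoc L (splitFormGL L) v a = epsLoc L (splitFormGL L) v a * ((a : GtLoc L v))⁻¹ := by
    have h := mul_comm_of_mem_centralizer_of_isRegularElt hγ₀ (epsLoc_mem_centralizer_coe γ₀ a.2) a.2
    calc ((a : GtLoc L v))⁻¹ * epsLoc L (splitFormGL L) v a = ((a : GtLoc L v))⁻¹ * (epsLoc L (splitFormGL L) v a * a) * ((a : GtLoc L v))⁻¹ := by group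
      _ = ((a : GtLoc L v))⁻¹ * (a * epsLoc L (splitFormGL L) v a) * ((a : GtLoc L v))⁻¹ := by rw [h]
      _ = epsLoc L (splitFormGL L) v a * ((a : GtLoc L v))⁻¹ := by group
  rw [Subgroup.coe_mul, hb_eq, map_inv, inv_inv, hc]
  group

/-! ## §3 Borel structure: the sheet maps, `B₀`, and the sheet measure -/

include hγ₀ hsN hRN in
/-- **Each sheet map `t ↦ s(t) u` is injective** on `T` (`u ∈ R`): the norm recovers `t`. [cite: Rogawski1990, §12.5 p. 186] -/
theorem injective_sheet (u : ↥(Subgroup.centralizer ({(γ₀.val : GtLoc L v)} : Set (GtLoc L v)))) (hu : u ∈ R) : Function.Injective fun t : ↥T => s t * u := by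
  intro t t' h
  have h1 := congrArg (fun b : ↥(Subgroup.centralizer ({(γ₀.val : GtLoc L v)} : Set (GtLoc L v))) => epsNorm (epsLoc L (splitFormGL L) v) (b : GtLoc L v)) h
  simp only [epsNorm_sheet hγ₀ s hsN R hRN _ u hu] at h1
  exact Subtype.ext (Subtype.ext h1)

variable [MeasurableSpace ((UnitaryGroup.cmDatum L 3 (splitFormGL L : Matrix (Fin 3) (Fin 3) L)).Local v)] [BorelSpace ((UnitaryGroup.cmDatum L 3 (splitFormGL L : Matrix (Fin 3) (Fin 3) L)).Local v)] [MeasurableSpace (GtLoc L v)] [BorelSpace (GtLoc L v)]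
  (hns : ∀ w : PlacesOver L v, IsCMField.complexConj L • w.1 = w.1) (hsm : Measurable s)

include hns hγ₀ hT hsN hRN hsm in
/-- **`B₀` is Borel** (`T` is standard Borel: a closed subgroup of the lcsc Hausdorff `U(Φ₃)(L⁺_v)`): each sheet `s(T^{reg}) u` is the image of the Borel set `T^{reg}` under an injective Borel map of the standard Borel space `T` (Lusin–Souslin).
[cite: Kechris1995, Thm. 15.1] [cite: Rogawski1990, §12.5 p. 186] -/
theorem measurableSet_sheetTransversal [SecondCountableTopology (GtLoc L v)] :
    MeasurableSet {b : ↥(Subgroup.centralizer ({(γ₀.val : GtLoc L v)} : Set (GtLoc L v))) | ∃ t : ↥T, IsRegularElt (((t : (UnitaryGroup.cmDatum L 3 (splitFormGL L : Matrix (Fin 3) (Fin 3) L)).Local v)).val : GtLoc L v) ∧ ∃ u ∈ R, b = s t * u} := by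
  classical
  -- `T` is a standard Borel space (closed subgroup of the lcsc Hausdorff `U(Φ₃)(L⁺_v)`)
  haveI : LocallyCompactSpace ((UnitaryGroup.cmDatum L 3 (splitFormGL L : Matrix (Fin 3) (Fin 3) L)).Local v) :=
    locallyCompactSpace_cmDatum_local (L := L) (N := 3) (H := (splitFormGL L : Matrix (Fin 3) (Fin 3) L)) (v := v)
  haveI : SecondCountableTopology (GL (Fin 3) (LocalRing L v)) := secondCountableTopology_localGL (E := L) 3 v
  haveI : SecondCountableTopology ((UnitaryGroup.cmDatum L 3 (splitFormGL L : Matrix (Fin 3) (Fin 3) L)).Local v) := TopologicalSpace.Subtype.secondCountableTopology _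
  haveI : PolishSpace ((UnitaryGroup.cmDatum L 3 (splitFormGL L : Matrix (Fin 3) (Fin 3) L)).Local v) :=
    Literature.Topology.Metrizable.polishSpace_of_locallyCompactSpace_of_secondCountableTopology _
  have hTcl : IsClosed (T : Set ((UnitaryGroup.cmDatum L 3 (splitFormGL L : Matrix (Fin 3) (Fin 3) L)).Local v)) := by
    rw [hT]; exact Set.isClosed_centralizer _
  haveI : PolishSpace ↥T := hTcl.polishSpace
  obtain ⟨w⟩ := (inferInstance : Nonempty (PlacesOver L v))
  have hregm : MeasurableSet {t : ↥T | IsRegularElt (((t : (UnitaryGroup.cmDatum L 3 (splitFormGL L : Matrix (Fin 3) (Fin 3) L)).Local v)).val : GtLoc L v)} :=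
    ((isOpen_setOf_isRegularElt_cmDatum_local (L := L) (H := (splitFormGL L : Matrix (Fin 3) (Fin 3) L)) (v := v) w (hns w)).preimage continuous_subtype_val).measurableSet
  have heq : {b : ↥(Subgroup.centralizer ({(γ₀.val : GtLoc L v)} : Set (GtLoc L v))) | ∃ t : ↥T, IsRegularElt (((t : (UnitaryGroup.cmDatum L 3 (splitFormGL L : Matrix (Fin 3) (Fin 3) L)).Local v)).val : GtLoc L v) ∧ ∃ u ∈ R, b = s t * u} =
      ⋃ u ∈ R, (fun t : ↥T => s t * u) '' {t : ↥T | IsRegularElt (((t : (UnitaryGroup.cmDatum L 3 (splitFormGL L : Matrix (Fin 3) (Fin 3) L)).Local v)).val : GtLoc L v)} := by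
    ext b
    simp only [mem_setOf_eq, mem_iUnion, mem_image, exists_prop]
    constructor
    · rintro ⟨t, ht, u, hu, rfl⟩
      exact ⟨u, hu, t, ht, rfl⟩
    · rintro ⟨u, hu, t, ht, rfl⟩
      exact ⟨t, ht, u, hu, rfl⟩
  rw [heq]
  refine MeasurableSet.biUnion R.countable_toSet fun u hu => ?_
  exact hregm.image_of_measurable_injOn (hsm.mul_const u) (injective_sheet hγ₀ s hsN R hRN u hu).injOn

omit [BorelSpace ((UnitaryGroup.cmDatum L 3 (splitFormGL L : Matrix (Fin 3) (Fin 3) L)).Local v)] in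
include hsm in
/-- **Integration against the SHEET MEASURE `λ = Σ_{u ∈ R} (t ↦ s(t) u)_*(μ)`** (Lebesgue form, any measure `μ` on `T`, Borel `s`): `∫⁻ F dλ = Σ_{u ∈ R} ∫⁻ F(s(t) u) dμ(t)`.
[cite: Rogawski1990, §12.5 p. 186] -/
theorem lintegral_sheetMeasure (μ : Measure ↥T) {F : ↥(Subgroup.centralizer ({(γ₀.val : GtLoc L v)} : Set (GtLoc L v))) → ℝ≥0∞} (hF : Measurable F) :
    ∫⁻ b, F b ∂(∑ u ∈ R, Measure.map (fun t : ↥T => s t * u) μ) = ∑ u ∈ R, ∫⁻ t, F (s t * u) ∂μ := by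
  rw [lintegral_finsetSum_measure]
  refine Finset.sum_congr rfl fun u _ => ?_
  rw [lintegral_map hF (hsm.mul_const u)]

omit [BorelSpace ((UnitaryGroup.cmDatum L 3 (splitFormGL L : Matrix (Fin 3) (Fin 3) L)).Local v)] in
include hsm in
/-- **Integration against the sheet measure, Bochner form**: for `F` integrable against `λ = Σ_{u ∈ R} (t ↦ s(t) u)_*(μ)`, `∫ F dλ = Σ_{u ∈ R} ∫ F(s(t) u) dμ(t)` (the summand
measures are dominated by `λ`, so `F` is a.e.-strongly measurable for each and the change of variables needs no embedding). [cite: Rogawski1990, §12.5 p. 186] -/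
theorem integral_sheetMeasure (μ : Measure ↥T) {E : Type*} [NormedAddCommGroup E] [NormedSpace ℝ E]
    {F : ↥(Subgroup.centralizer ({(γ₀.val : GtLoc L v)} : Set (GtLoc L v))) → E} (hF : Integrable F (∑ u ∈ R, Measure.map (fun t : ↥T => s t * u) μ)) :
    ∫ b, F b ∂(∑ u ∈ R, Measure.map (fun t : ↥T => s t * u) μ) = ∑ u ∈ R, ∫ t, F (s t * u) ∂μ := by
  classical
  have hle : ∀ u ∈ R, Measure.map (fun t : ↥T => s t * u) μ ≤ ∑ u' ∈ R, Measure.map (fun t : ↥T => s t * u') μ := fun u hu =>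
    calc Measure.map (fun t : ↥T => s t * u) μ ≤ Measure.map (fun t : ↥T => s t * u) μ + ∑ u' ∈ R.erase u, Measure.map (fun t : ↥T => s t * u') μ :=
        Measure.le_add_right le_rfl
      _ = ∑ u' ∈ R, Measure.map (fun t : ↥T => s t * u') μ := Finset.add_sum_erase R (fun u' => Measure.map (fun t : ↥T => s t * u') μ) hu
  rw [integral_finsetSum_measure fun u hu => hF.mono_measure (hle u hu)]
  refine Finset.sum_congr rfl fun u hu => ?_
  rw [integral_map (hsm.mul_const u).aemeasurable (hF.aestronglyMeasurable.mono_measure (hle u hu))]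

end Sheets

end Summit.HodgeConjecture.HodgeConjecture.R90.S4

end
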